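import Summits.QuantumFields.BalabanUV.T4Continuum.Support.NE3ClassSlicePoincare
import HarnessLib

/-!
# NE3ClassRadiusFamily (T⁴ programme, node NE3 = U1b, row NE3-R2, K-g12-1) — THE CLASS-RADIUS FAMILY `hsmall` IS A THEOREM:
# `∀ j, LevelSmall d L (j+1) (ε ∕ (L^{j+2})²)` FROM TWO k-FREE NUMERIC LINES ON `ε`; `0 ≤ CPLine`; the SU(2) corollary with `hsmall` GONE

Row NE3-R2 (`b2b-balaban-t4-ne3r2-p1`, gen 12).  Answers `t4/formal/NE3/REFEREE.md` PASS 31 INFO-74 («the Y9 family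
`∀ j, LevelSmall d L (j+1) (ε∕(L^{j+2})²)` has NO kernel witness in the tree (`levelSmall_of_pow` loses `2^{j+1}`) … a lemma owed by
whoever composes `classSlicePoincare_SU2` into the END») and removes the displayed `hCP : 0 ≤ CPLine …` of the owner's
`NE3EnergyRateWSupLines.ne3EnergyRateWSup_sfClass_of_lines` (p243157).

CONTENT (all [folklore]; 0 sorry; 0 def):
§1 `radSum_succ_eq` (`radSum (j+1) x = radSum j x + radIter (j+1) x`) and the k-FREE BOOTSTRAP **`radIter_radSum_le_of_small`**:
   for `L ≥ 2`, `x ≥ 0` and ONE smallness `c₁L²·(8∕3)·(L²)^j·x ≤ 1∕2` (`c₁ = 14464(d+1)²(d+4)²`), EVERY radius obeys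
   `radIter d L j x ≤ 2·(L²)^j·x` and `radSum d L j x ≤ (8∕3)·(L²)^j·x` — induction on `j` through this row's K-g10-1 product step
   `NE3TopRadiusLetters.radIter_le_of_lowSum` (the lower radii are summed by the PREVIOUS level's bound, so the level factors never
   multiply up: no `(1+c)^j`).
§2 `levelSmall_of_forall_radIter` (`(∀ i ≤ j, twoLevelSmall·radIter i x ≤ 1) → LevelSmall d L j x`, the unfolding of the recursive
   definition) and **`levelSmall_of_small`**: `LevelSmall d L j x` from the two k-free lines `c₁L²(8∕3)(L²)^j x ≤ 1∕2`, `2·twoLevelSmall·(L²)^j·x ≤ 1`.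
§3 **`levelSmall_family`**: `2 ≤ L`, `0 ≤ ε`, `16·c₁·ε ≤ 3`, `2·twoLevelSmall d L·ε ≤ L²` ⟹ `∀ j, LevelSmall d L (j+1) (ε∕(L^{j+2})²)`
   (`(L²)^{j+1}·ε∕(L^{j+2})² = ε∕L²`, level-free); **`levelSmall_family_d4_L2`**: at `d = 4`, `L = 2` it holds for every `0 ≤ ε ≤ 10⁻¹¹`.
§4 `lrTop_nonneg` … `KhLine_pos`, **`CPLine_nonneg`** (`1 ≤ d`, `0 ≤ c`, `0 ≤ ε`, `0 ≤ θ`), `CPLine_nonneg_d4_L2`.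
§5 **`classSlicePoincare_of_lines'`** = K-g11-1's `classSlicePoincare_of_lines` with `hsmall` REPLACED by the two ε-lines of §3, and
   **`classSlicePoincare_SU2'`**: `d = 4`, `L = 2`, `card n = 2`, every `N ≥ 1`, every `0 < ε ≤ 10⁻⁵³` ⟹ (P♮)_W on the whole class
   `sfClass 4 2 N ε (j+1)` for every `j`, constant `CPLine 4 2 2 10⁻¹⁷ 10⁻⁵³` — NO `hsmall`, no numeric hypothesis left.

HONEST FRAMING.  Elementary real arithmetic on OUR radius recursion (`prop1Radius`, `radIter`, `radSum`, `LevelSmall`) and on the line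
polynomials of K-g11-1; nothing about Bałaban's minimisers; (P♮)_W itself is leaf-02's K6c-2b; the END's `hchart` (route Π), `hbudget`, `hreg₁`,
(H∃) are untouched; NE3 NOT proved; spine PROVED 0∕9; finite T⁴ rung (B)+1 — NOT infinite volume, NOT mass gap, NOT `BetaPertH`, NOT Clay.
PLACEMENT: `Summits/QuantumFields/BalabanUV/`; imports this row's `NE3ClassSlicePoincare` (p241642) only; moves nothing.
HONEST DEPENDENCY: continuum YM on T⁴ ⇐ BetaPertH ∧ nine spine estimates (0/9 proved); BetaPertH ⇐ (D1) ∧ (D4) ∧ CAP+tail; G-an2-4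
gates asym, D1 and NE2/3/4.
-/

set_option autoImplicit false

namespace Summit.QuantumFields.BalabanUV.T4Continuum.NE3ClassRadiusFamily

open Literature.MathematicalPhysics.QuantumFieldTheory.Balaban1983to89
open B7Prop1Explicit B7Prop2Explicit
open T4AveragingDeficitWallBoundary (periodBox)
open AveragingDeficitTwoLevelPrep (twoLevelSmall prop1Radius)
open AveragingDeficitMultiLevelPrep (LevelSmall radIter prop1Radius_nonneg)
open ReplicationRightInverseBound (radSum radSum_nonneg)
open NE3TopRadiusLetters (radIter_le_of_lowSum radIter_le_radSum)
open NE3CovariantLineSumsL2 (C2sq)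
open NE3CovariantLineSumsL2Tower (rho)
open MinimalActionRate (sfClass)
open NE3SlicePoincareShape (SlicePoincare)
open NE3FrameFreeSliceW (frameFreeBlockLandauW)
open NE3SlicePoincareBudgetLine
open NE3ClassSlicePoincare (classSlicePoincare_of_lines classSlicePoincare_SU2)

noncomputable section

variable {d : ℕ}

/-! ## §1 The k-free bootstrap of the radii -/

/-- `radSum (j+1) x = radSum j x + radIter (j+1) x`: the sum of the radii down the tower is the sum over levels `0 … j+1` of the
iterated radii at the SAME `x`. [folklore] -/
theorem radSum_succ_eq (L : ℕ) : ∀ (j : ℕ) (x : ℝ), radSum d L (j + 1) x = radSum d L j x + radIter d L (j + 1) x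
  | 0, x => by simp [radSum, radIter]
  | j + 1, x => by
      show x + radSum d L (j + 1) (prop1Radius d L x) = (x + radSum d L j (prop1Radius d L x)) + radIter d L (j + 1) (prop1Radius d L x)
      rw [radSum_succ_eq L j (prop1Radius d L x)]
      ring

/-- **THE k-FREE BOOTSTRAP** (`L ≥ 2`, `x ≥ 0`): ONE smallness at the top, `c₁L²·(8∕3)·(L²)^j·x ≤ 1∕2` with `c₁ = 14464(d+1)²(d+4)²`,
gives at every level `radIter d L j x ≤ 2·(L²)^j·x` and `radSum d L j x ≤ (8∕3)·(L²)^j·x`.  Induction on `j`: the lower radii are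
bounded by the previous step's `radSum` estimate, which feeds K-g10-1's product step `radIter_le_of_lowSum` at the new top level; the
geometric growth `(L²)^j ≤ (L²)^{j+1}∕4` closes the `radSum` bound. [folklore] -/
theorem radIter_radSum_le_of_small {L : ℕ} (hL : 2 ≤ L) : ∀ (j : ℕ) {x : ℝ}, 0 ≤ x →
    14464 * ((d : ℝ) + 1) ^ 2 * ((d : ℝ) + 4) ^ 2 * (L : ℝ) ^ 2 * (8 / 3 * (((L : ℝ) ^ 2) ^ j * x)) ≤ 1 / 2 →
    radIter d L j x ≤ 2 * (((L : ℝ) ^ 2) ^ j * x) ∧ radSum d L j x ≤ 8 / 3 * (((L : ℝ) ^ 2) ^ j * x)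
  | 0, x, hx, _ => by
      simp only [radIter, radSum, pow_zero, one_mul]
      constructor <;> linarith
  | j + 1, x, hx, h => by
      have hL2 : (2 : ℝ) ≤ L := by exact_mod_cast hL
      have hL4 : (4 : ℝ) ≤ (L : ℝ) ^ 2 := by nlinarith
      have hLj : 0 ≤ ((L : ℝ) ^ 2) ^ j * x := by positivity
      have hLj1 : 0 ≤ ((L : ℝ) ^ 2) ^ (j + 1) * x := by positivity
      have hgrow : ((L : ℝ) ^ 2) ^ j * x * 4 ≤ ((L : ℝ) ^ 2) ^ (j + 1) * x := by
        have e : ((L : ℝ) ^ 2) ^ (j + 1) = ((L : ℝ) ^ 2) ^ j * (L : ℝ) ^ 2 := pow_succ _ _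
        rw [e]
        have := mul_le_mul_of_nonneg_left hL4 hLj
        nlinarith [this]
      have hmono : ((L : ℝ) ^ 2) ^ j * x ≤ ((L : ℝ) ^ 2) ^ (j + 1) * x := by linarith
      have hc0 : (0 : ℝ) ≤ 14464 * ((d : ℝ) + 1) ^ 2 * ((d : ℝ) + 4) ^ 2 * (L : ℝ) ^ 2 := by positivity
      have h' : 14464 * ((d : ℝ) + 1) ^ 2 * ((d : ℝ) + 4) ^ 2 * (L : ℝ) ^ 2 * (8 / 3 * (((L : ℝ) ^ 2) ^ j * x)) ≤ 1 / 2 :=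
        le_trans (mul_le_mul_of_nonneg_left (by linarith) hc0) h
      obtain ⟨-, hS⟩ := radIter_radSum_le_of_small hL j hx h'
      -- the lower radii at level `j+1` are `radSum j`
      have hsub : radSum d L (j + 1) x - radIter d L (j + 1) x = radSum d L j x := by
        rw [radSum_succ_eq]; ring
      have hlow : 14464 * ((d : ℝ) + 1) ^ 2 * ((d : ℝ) + 4) ^ 2 * (L : ℝ) ^ 2 * (radSum d L (j + 1) x - radIter d L (j + 1) x) ≤ 1 / 2 := by
        rw [hsub]
        exact le_trans (mul_le_mul_of_nonneg_left (hS.trans (by linarith)) hc0) h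
      have hr := radIter_le_of_lowSum (d := d) L (j + 1) hx hlow
      have hr2 : radIter d L (j + 1) x ≤ 2 * (((L : ℝ) ^ 2) ^ (j + 1) * x) := by
        calc radIter d L (j + 1) x
            ≤ ((L : ℝ) ^ 2) ^ (j + 1) * x * (1 + 2 * (14464 * ((d : ℝ) + 1) ^ 2 * ((d : ℝ) + 4) ^ 2 * (L : ℝ) ^ 2
                * (radSum d L (j + 1) x - radIter d L (j + 1) x))) := hr
          _ ≤ ((L : ℝ) ^ 2) ^ (j + 1) * x * 2 := mul_le_mul_of_nonneg_left (by linarith) hLj1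
          _ = 2 * (((L : ℝ) ^ 2) ^ (j + 1) * x) := by ring
      refine ⟨hr2, ?_⟩
      rw [radSum_succ_eq]
      linarith

/-! ## §2 `LevelSmall` from the radii -/

/-- The recursive definition unfolded: if every iterated radius satisfies the two-level smallness, `twoLevelSmall·radIter i x ≤ 1` for
`i ≤ j`, then `LevelSmall d L j x` (`radIter (i+1) x = radIter i (prop1Radius x)` by definition). [folklore] -/
theorem levelSmall_of_forall_radIter (L : ℕ) : ∀ (j : ℕ) (x : ℝ),
    (∀ i : ℕ, i ≤ j → twoLevelSmall d L * radIter d L i x ≤ 1) → LevelSmall d L j x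
  | 0, x, h => by
      have h0 := h 0 le_rfl
      simpa [LevelSmall, radIter] using h0
  | j + 1, x, h => by
      have h0 := h 0 (Nat.zero_le _)
      simp only [radIter] at h0
      refine ⟨h0, levelSmall_of_forall_radIter L j (prop1Radius d L x) fun i hi => ?_⟩
      have hi' := h (i + 1) (by omega)
      simpa [radIter] using hi'

/-- **`LevelSmall` FROM TWO k-FREE LINES** (`L ≥ 2`, `x ≥ 0`): `c₁L²·(8∕3)·(L²)^j·x ≤ 1∕2` and `2·twoLevelSmall d L·(L²)^j·x ≤ 1` imply
`LevelSmall d L j x`. [folklore] -/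
theorem levelSmall_of_small {L : ℕ} (hL : 2 ≤ L) (j : ℕ) {x : ℝ} (hx : 0 ≤ x)
    (h1 : 14464 * ((d : ℝ) + 1) ^ 2 * ((d : ℝ) + 4) ^ 2 * (L : ℝ) ^ 2 * (8 / 3 * (((L : ℝ) ^ 2) ^ j * x)) ≤ 1 / 2)
    (h2 : 2 * twoLevelSmall d L * (((L : ℝ) ^ 2) ^ j * x) ≤ 1) : LevelSmall d L j x := by
  have hL1 : (1 : ℝ) ≤ (L : ℝ) ^ 2 := by
    have : (2 : ℝ) ≤ L := by exact_mod_cast hL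
    nlinarith
  have hT : 0 ≤ twoLevelSmall d L := by unfold twoLevelSmall; positivity
  have hc0 : (0 : ℝ) ≤ 14464 * ((d : ℝ) + 1) ^ 2 * ((d : ℝ) + 4) ^ 2 * (L : ℝ) ^ 2 := by positivity
  apply levelSmall_of_forall_radIter L j x
  intro i hi
  have hpow : ((L : ℝ) ^ 2) ^ i * x ≤ ((L : ℝ) ^ 2) ^ j * x :=
    mul_le_mul_of_nonneg_right (pow_le_pow_right₀ hL1 hi) hx
  have h1i : 14464 * ((d : ℝ) + 1) ^ 2 * ((d : ℝ) + 4) ^ 2 * (L : ℝ) ^ 2 * (8 / 3 * (((L : ℝ) ^ 2) ^ i * x)) ≤ 1 / 2 :=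
    le_trans (mul_le_mul_of_nonneg_left (by linarith) hc0) h1
  obtain ⟨hr, -⟩ := radIter_radSum_le_of_small hL i hx h1i
  calc twoLevelSmall d L * radIter d L i x ≤ twoLevelSmall d L * (2 * (((L : ℝ) ^ 2) ^ i * x)) := mul_le_mul_of_nonneg_left hr hT
    _ ≤ twoLevelSmall d L * (2 * (((L : ℝ) ^ 2) ^ j * x)) := mul_le_mul_of_nonneg_left (by linarith) hT
    _ ≤ 1 := by linarith

/-! ## §3 The class-radius family -/

/-- **THE CLASS-RADIUS FAMILY `hsmall` IS A THEOREM** (`L ≥ 2`, `ε ≥ 0`): the two k-free numeric lines `16·c₁·ε ≤ 3`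
(`c₁ = 14464(d+1)²(d+4)²`) and `2·twoLevelSmall d L·ε ≤ L²` give `LevelSmall d L (j+1) (ε∕(L^{j+2})²)` for EVERY `j` — the family
hypothesis of `NE3ClassSlicePoincare.classSlicePoincare_of_lines` ∕ `_SU2` and of the owner's END
`NE3EnergyRateWSupLines.ne3EnergyRateWSup_sfClass_of_lines` (the level-`j+1` top letter is `(L²)^{j+1}·ε∕(L^{j+2})² = ε∕L²`, level-free).
[folklore] -/
theorem levelSmall_family {L : ℕ} (hL : 2 ≤ L) {ε : ℝ} (hε : 0 ≤ ε)
    (h1 : 16 * (14464 * ((d : ℝ) + 1) ^ 2 * ((d : ℝ) + 4) ^ 2) * ε ≤ 3)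
    (h2 : 2 * twoLevelSmall d L * ε ≤ (L : ℝ) ^ 2) :
    ∀ j : ℕ, LevelSmall d L (j + 1) (ε / ((L : ℝ) ^ (j + 2)) ^ 2) := by
  intro j
  have hL0 : (0 : ℝ) < L := by exact_mod_cast (show 0 < L by omega)
  have hL2pos : (0 : ℝ) < (L : ℝ) ^ 2 := by positivity
  have key : ((L : ℝ) ^ 2) ^ (j + 1) * (ε / ((L : ℝ) ^ (j + 2)) ^ 2) = ε / (L : ℝ) ^ 2 := by
    have hne : ((L : ℝ) ^ (j + 2)) ^ 2 ≠ 0 := by positivity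
    have hne2 : (L : ℝ) ^ 2 ≠ 0 := by positivity
    field_simp
    ring
  apply levelSmall_of_small hL (j + 1) (by positivity)
  · rw [key]
    have e : 14464 * ((d : ℝ) + 1) ^ 2 * ((d : ℝ) + 4) ^ 2 * (L : ℝ) ^ 2 * (8 / 3 * (ε / (L : ℝ) ^ 2))
        = 8 / 3 * (14464 * ((d : ℝ) + 1) ^ 2 * ((d : ℝ) + 4) ^ 2) * ε := by
      field_simp
    rw [e]
    linarith
  · rw [key]
    have e : 2 * twoLevelSmall d L * (ε / (L : ℝ) ^ 2) = (2 * twoLevelSmall d L * ε) / (L : ℝ) ^ 2 := by ring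
    rw [e, div_le_one hL2pos]
    exact h2

/-- **AT `d = 4`, `L = 2`**: the class-radius family holds for every `0 ≤ ε ≤ 10⁻¹¹` (`16·c₁ = 16·14464·25·64 = 370 278 400`,
`2·twoLevelSmall 4 2 = 2·65536·25·64·2⁸ = 53 687 091 200 ≤ 4·10¹¹`). [folklore] -/
theorem levelSmall_family_d4_L2 {ε : ℝ} (hε : 0 ≤ ε) (hε' : ε ≤ 1 / 10 ^ 11) :
    ∀ j : ℕ, LevelSmall 4 2 (j + 1) (ε / (((2 : ℕ) : ℝ) ^ (j + 2)) ^ 2) := by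
  refine levelSmall_family (d := 4) (by norm_num) hε ?_ ?_
  · norm_num at hε' ⊢
    linarith
  · unfold twoLevelSmall
    norm_num at hε' ⊢
    linarith

/-! ## §4 `0 ≤ CPLine` -/

/-- `0 ≤ lrTop d θ` for `θ ≥ 0`. [folklore] -/
theorem lrTop_nonneg (d : ℕ) {θ : ℝ} (hθ : 0 ≤ θ) : 0 ≤ lrTop d θ := by unfold lrTop; positivity

/-- `0 ≤ cjTop d θ` for `θ ≥ 0`. [folklore] -/
theorem cjTop_nonneg (d : ℕ) {θ : ℝ} (hθ : 0 ≤ θ) : 0 ≤ cjTop d θ := by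
  have := lrTop_nonneg d hθ
  unfold cjTop; positivity

/-- `0 ≤ (d − 1)·θ` for `d ≥ 1`, `θ ≥ 0` (the one letter with a subtraction). [folklore] -/
theorem dsub_mul_nonneg {d : ℕ} (hd : 1 ≤ d) {θ : ℝ} (hθ : 0 ≤ θ) : 0 ≤ ((d : ℝ) - 1) * θ := by
  have : (0 : ℝ) ≤ (d : ℝ) - 1 := by
    have : (1 : ℝ) ≤ d := by exact_mod_cast hd
    linarith
  exact mul_nonneg this hθ

/-- `0 ≤ cfTop d θ` for `d ≥ 1`, `θ ≥ 0`. [folklore] -/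
theorem cfTop_nonneg {d : ℕ} (hd : 1 ≤ d) {θ : ℝ} (hθ : 0 ≤ θ) : 0 ≤ cfTop d θ := by
  have h1 := lrTop_nonneg d hθ
  have h2 := dsub_mul_nonneg hd hθ
  unfold cfTop; positivity

/-- `0 ≤ qTop d θ` (a square; any `θ`). [folklore] -/
theorem qTop_nonneg (d : ℕ) (θ : ℝ) : 0 ≤ qTop d θ := by
  unfold qTop; positivity

/-- `0 ≤ gTop d c θ` for `c, θ ≥ 0`. [folklore] -/
theorem gTop_nonneg (d : ℕ) {c θ : ℝ} (hc : 0 ≤ c) (hθ : 0 ≤ θ) : 0 ≤ gTop d c θ := by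
  have := cjTop_nonneg d hθ
  unfold gTop; positivity

/-- `0 ≤ bhTop d L c θ` for `c ≥ 0` (any `θ`: it enters through squares). [folklore] -/
theorem bhTop_nonneg (d L : ℕ) {c : ℝ} (θ : ℝ) (hc : 0 ≤ c) : 0 ≤ bhTop d L c θ := by
  have := qTop_nonneg d θ
  unfold bhTop; positivity

/-- `0 ≤ ALine d c ε θ` for `d ≥ 1`, `c, θ ≥ 0` (any `ε`: the letter enters through `ε²`). [folklore] -/
theorem ALine_nonneg {d : ℕ} (hd : 1 ≤ d) {c ε θ : ℝ} (hc : 0 ≤ c) (hθ : 0 ≤ θ) : 0 ≤ ALine d c ε θ := by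
  have := cfTop_nonneg hd hθ
  unfold ALine; positivity

/-- `0 < KhLine d L c ε θ` for `c, θ ≥ 0`, `ε ≥ 0`. [folklore] -/
theorem KhLine_pos (d L : ℕ) {c ε θ : ℝ} (hc : 0 ≤ c) (hε : 0 ≤ ε) (hθ : 0 ≤ θ) : 0 < KhLine d L c ε θ := by
  have h1 := gTop_nonneg d hc hθ
  have h2 := bhTop_nonneg d L θ hc
  unfold KhLine; positivity

/-- **`0 ≤ CPLine d L c ε θ`** for `d ≥ 1`, `c, ε, θ ≥ 0` — the displayed `hCP` of the owner's END is discharged for every admissible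
letter. [folklore] -/
theorem CPLine_nonneg {d L : ℕ} (hd : 1 ≤ d) {c ε θ : ℝ} (hc : 0 ≤ c) (hε : 0 ≤ ε) (hθ : 0 ≤ θ) : 0 ≤ CPLine d L c ε θ := by
  have h1 := ALine_nonneg hd hc hθ (ε := ε)
  have h2 := (KhLine_pos d L hc hε hθ).le
  unfold CPLine; positivity

/-- `0 ≤ CPLine 4 2 2 10⁻¹⁷ 10⁻⁵³` (the SU(2) constant of record). [folklore] -/
theorem CPLine_nonneg_d4_L2 : 0 ≤ CPLine 4 2 2 (1 / 10 ^ 17) (1 / 10 ^ 53) :=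
  CPLine_nonneg (by norm_num) (by norm_num) (by norm_num) (by norm_num)

/-! ## §5 (P♮)_W on the class with `hsmall` gone -/

variable {n : Type*} [Fintype n] [DecidableEq n]

/-- **K-g11-1's `classSlicePoincare_of_lines` WITH THE FAMILY DISCHARGED**: `3 ≤ d`, `2 ≤ L`, `1 ≤ N`, `0 < ε ≤ θ`, `0 < εc`, the two
ε-lines `16·c₁·ε ≤ 3`, `2·twoLevelSmall d L·ε ≤ L²`, and the four K-road lines ⟹ (P♮)_W on `sfClass d L N ε (j+1)` for every `j` with
the one constant `CPLine d L (card n) εc θ`. [folklore] -/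
theorem classSlicePoincare_of_lines' [Nonempty n] (hd : 3 ≤ d) {L N : ℕ} (hL : 2 ≤ L) (hN : 1 ≤ N) {ε θ εc : ℝ}
    (hε : 0 < ε) (hεθ : ε ≤ θ) (hεc : 0 < εc)
    (hε1 : 16 * (14464 * ((d : ℝ) + 1) ^ 2 * ((d : ℝ) + 4) ^ 2) * ε ≤ 3)
    (hε2 : 2 * twoLevelSmall d L * ε ≤ (L : ℝ) ^ 2)
    (h1 : ShLine d L (Fintype.card n) εc θ ≤ 1 / 2) (h2 : SmallYLine d L (Fintype.card n) εc θ ≤ 1 / 2)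
    (h3 : 68 / 3 * (((d : ℝ) + 1) * ((d : ℝ) + 4)) * C2sq d L * θ ≤ rho d L / 2)
    (h4 : 8 * d * (((d : ℝ) - 1) * θ) ^ 2
      + 2 * ((Fintype.card n : ℝ) * ((4 * (d : ℝ) ^ 2 + 272 * d * (((d : ℝ) + 1) * ((d : ℝ) + 4))) * θ) ^ 2) ≤ 1 / 2) :
    ∀ j : ℕ, ∀ W : Site d → Fin d → (Matrix n n ℂ)ˣ, W ∈ sfClass d L N ε (j + 1) →
      SlicePoincare L (j + 1) W (frameFreeBlockLandauW L N (j + 1) W) (CPLine d L (Fintype.card n) εc θ)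
        (periodBox (N * L ^ (j + 1))) :=
  classSlicePoincare_of_lines hd hL hN hε hεθ hεc (levelSmall_family hL hε.le hε1 hε2) h1 h2 h3 h4

/-- **(P♮)_W ON THE WHOLE SU(2) CLASS AT `d = 4`, `L = 2`, NO NUMERIC HYPOTHESIS LEFT**: every `N ≥ 1`, every class radius
`0 < ε ≤ 10⁻⁵³`, every level `j+1`, every `W ∈ sfClass 4 2 N ε (j+1)`:
`SlicePoincare 2 (j+1) W (T_♮(W)) (CPLine 4 2 2 10⁻¹⁷ 10⁻⁵³) (periodBox (N·2^{j+1}))` — K-g11-1's `classSlicePoincare_SU2` with its last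
displayed hypothesis `hsmall` supplied by `levelSmall_family_d4_L2`. [folklore] -/
theorem classSlicePoincare_SU2' [Nonempty n] (hn : Fintype.card n = 2) {N : ℕ} (hN : 1 ≤ N) {ε : ℝ} (hε : 0 < ε)
    (hε' : ε ≤ 1 / 10 ^ 53) :
    ∀ j : ℕ, ∀ W : Site 4 → Fin 4 → (Matrix n n ℂ)ˣ, W ∈ sfClass 4 2 N ε (j + 1) →
      SlicePoincare 2 (j + 1) W (frameFreeBlockLandauW 2 N (j + 1) W) (CPLine 4 2 2 (1 / 10 ^ 17) (1 / 10 ^ 53))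
        (periodBox (N * 2 ^ (j + 1))) :=
  classSlicePoincare_SU2 hn hN hε hε' (levelSmall_family_d4_L2 hε.le (hε'.trans (by norm_num)))

end

end Summit.QuantumFields.BalabanUV.T4Continuum.NE3ClassRadiusFamily
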